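import Mathlib
import HarnessLib
import Summits.AnomalousDissipation.AnomalousDissipation.Theses.DyadicWallCascade
import Summits.AnomalousDissipation.AnomalousDissipation.Theorems.DyadicWallCascadeViscousContinuationStubLapRecursionSeries
import Summits.AnomalousDissipation.AnomalousDissipation.Theorems.DyadicWallCascadeViscousContinuationStubLapRecursionLipschitz
import Summits.AnomalousDissipation.AnomalousDissipation.Theorems.DyadicWallCascadeViscousContinuationStubDoublingTransferContracts
import Summits.AnomalousDissipation.AnomalousDissipation.Theorems.DyadicWallCascadeViscousContinuationStubBlowDownOfFarField
import Summits.AnomalousDissipation.AnomalousDissipation.Theorems.DyadicWallCascadeViscousContinuationStubFluxNeg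
import Summits.AnomalousDissipation.AnomalousDissipation.Theorems.DyadicWallCascadeViscousContinuationStubSaintVenant
import Summits.AnomalousDissipation.AnomalousDissipation.Theorems.DyadicWallCascadeViscousContinuationStubSeedIffHierarchy
import Summits.AnomalousDissipation.AnomalousDissipation.Theorems.DyadicWallCascadeViscousContinuationStubFarFieldIffViscousWallProfile

/-!
# Line `Sketch` — crux `DyadicWallCascade.ViscousContinuation` (stmt-AnomalousDissipation-17917), skeleton v3

Lead skeleton (prover-line-stmt-AnomalousDissipation-17917-0, 2026-08-17). The crux is
`HalfSpaceHierarchy → ViscousWallProfile` (the conclusion re-quantifies the hierarchy, so it is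
literally the free-standing block `ViscousWallProfile`, item stmt-AnomalousDissipation-17919).

THE LINE (`Sketch` = the k2 ideator's `Sketch.lean`, cards `lap-map-koopman-transfer` +
`saint-venant-cap-impedance`; the evidence file itself is not mounted in this seat's jail, so the
statements below are RECONSTRUCTED from the two cards in `Cruxes/ViscousContinuation/Ideas/`).
Mechanism claimed by the cards: organise `V ↦ W` along the two Bernoulli-forced through-flow trees —
a weight-½ Koopman recursion `g ∘ τ = (g + I)/2` down the rigid descending tree (lap map `τ`), a
transfer-operator (merge-averaging) up the ascending tree, and the viscous cap `0 < z < h` solved as an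
aperiodic LAYER problem by Ladyzhenskaya–Solonnikov Saint-Venant estimates; `W` = fixed point of the
triangular map (descending slaving) ∘ (cap impedance) ∘ (ascending averaging); blow-downs converge to a
cap-compatible hierarchy `V̂` (V FLOATS: the conclusion's hierarchy is an output).

CHAIN (sorries only in `stub_*`; `ViscousContinuation_of` concludes the route decl BY NAME):
  `HalfSpaceHierarchy` ⟹ (stub_fluxNeg, M, provable: `V ↦ −V`) a hierarchy with `F < 0`
  ⟹ (stub_farFieldWallProfile, XL — the line's transfer target C⁺ in its weakest honest form: the whole
     analytic programme of the two cards lives inside this one stub) a bounded smooth mirror-symmetric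
     force-free steady NS pair `(W, P)` on `ℝ³` converging to SOME hierarchy `(V, Q)` UNIFORMLY AS
     `z → +∞`
  ⟹ (stub_blowDownOfFarField, S, provable: dilation invariance of `(V, Q)`) the dyadic band blow-down
     clause of the crux ⟹ crux.
TOY FIRST LEMMAS of the line (registered so that they can land `--supports`; they are the cards' in-Lean
falsifiers F2 and do NOT feed the chain): `stub_lapRecursionSeries`, `stub_lapRecursionLipschitz`,
`stub_doublingTransferContracts` (card lap-map-koopman-transfer), `stub_saintVenant` (card
saint-venant-cap-impedance: Saint-Venant dichotomy ∧ its Liouville use-shape).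

STATUS v3 (2026-08-17T09:35Z, end of cycle 1). LANDED (8/9, `Theorems/DyadicWallCascadeViscousContinuationStub*.lean`):
toy `stub_lapRecursionSeries` p146612, `stub_lapRecursionLipschitz` p146646, `stub_doublingTransferContracts`
p146557, `stub_saintVenant` p148853; chain flanks `stub_fluxNeg` p148890, `stub_blowDownOfFarField` p146560;
costume certificate `stub_seedIffHierarchy` p150090, `stub_farFieldIffViscousWallProfile` p149958. OPEN: the core
`stub_farFieldWallProfile` only — and `farFieldWallProfile_iff_viscousContinuation` below (sorry-free) proves it is
EQUIVALENT to the crux: the line is a COSTUME (verdict `line-dead: Sketch`, note `Lines/Sketch.dead.md`).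

Disproof.lean for this crux: v1–v3 published 06:54Z–07:48Z (cdisprove) and READ: §1 `¬crux ↔ HSH ∧ ¬VWP`,
mod (L) = `LiouvilleConjectureNS` the crux ⇔ `¬HalfSpaceHierarchy`; §3 refuted strengthenings landed p146569; §4
targets on this line — all flank/toy stubs TRUE, the core certified a costume independently
(`farFieldWallProfile_iff_viscousWallProfile`), `farField_of_blowDown` proved there (adapted, with credit, in
p149958); §5 rate obstruction (blow-down not faster than `2^{-m}`, paper proof) and the open Liouville statement.
(At skeleton v1 time, 06:45Z, none was published; payload `disproof_path` is another seat's folder, not mounted here.)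
-/

noncomputable section

-- `Summit.<Summit>.<Problem>`: single-conjunct summit, the duplicate namespace is mandated (CONVENTIONS §2).
set_option linter.dupNamespace false

namespace Summit.AnomalousDissipation.AnomalousDissipation.Cruxes.ViscousContinuation.Sketch

open MeasureTheory Filter Topology Set
open Summit.AnomalousDissipation.AnomalousDissipation.Theses.DyadicWallCascade

/-- Local notation: Euclidean 3-space. Stub files redeclare it verbatim. -/
local notation "E³" => EuclideanSpace ℝ (Fin 3)

/-! ## Toy first lemmas of the line (registered stubs, off the chain) -/

/-- **Stub (toy, S) — lap-recursion Neumann series** (card lap-map-koopman-transfer, First lemma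
`LapRecursionSeries`): for a bijection `τ` (the lap map on the descending section) and a bounded lap
integral `I`, the series `g q = ∑ₙ (1/2)^(n+1) I (τ⁻¹^[n+1] q)` is bounded by the same constant, solves the
weight-½ Koopman recursion `g (τ q) = (g q + I q)/2`, and is the unique bounded solution. [folklore] -/
theorem stub_lapRecursionSeries :
    ∀ {α : Type*} (τ : α ≃ α) (I : α → ℝ) (C : ℝ), (∀ q, |I q| ≤ C) →
      (∀ q, |∑' n : ℕ, (1 / 2 : ℝ) ^ (n + 1) * I ((⇑τ.symm)^[n + 1] q)| ≤ C) ∧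
      (∀ q, (∑' n : ℕ, (1 / 2 : ℝ) ^ (n + 1) * I ((⇑τ.symm)^[n + 1] (τ q))) =
        ((∑' n : ℕ, (1 / 2 : ℝ) ^ (n + 1) * I ((⇑τ.symm)^[n + 1] q)) + I q) / 2) ∧
      (∀ g : α → ℝ, (∃ C' : ℝ, ∀ q, |g q| ≤ C') → (∀ q, g (τ q) = (g q + I q) / 2) →
        ∀ q, g q = ∑' n : ℕ, (1 / 2 : ℝ) ^ (n + 1) * I ((⇑τ.symm)^[n + 1] q)) :=
  -- LANDED p146612 (accepted 2026-08-17): Theorems/DyadicWallCascadeViscousContinuationStub….lean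
  Summit.AnomalousDissipation.AnomalousDissipation.Theorems.stub_lapRecursionSeries

/-- **Stub (toy, S/M) — `C¹` slaving under the non-expanding inverse lap map** (card
lap-map-koopman-transfer, `LapRecursionLipschitz`): if `τ⁻¹` is 1-Lipschitz and the bounded lap integral
`I` is `K`-Lipschitz then the Neumann-series solution is `K`-Lipschitz. [folklore] -/
theorem stub_lapRecursionLipschitz :
    ∀ {α : Type*} [PseudoMetricSpace α] (τ : α ≃ α) (I : α → ℝ) (C : ℝ) (K : NNReal),
      (∀ q, |I q| ≤ C) → LipschitzWith 1 (⇑τ.symm) → LipschitzWith K I →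
      LipschitzWith K (fun q => ∑' n : ℕ, (1 / 2 : ℝ) ^ (n + 1) * I ((⇑τ.symm)^[n + 1] q)) :=
  -- LANDED p146646 (accepted 2026-08-17): Theorems/DyadicWallCascadeViscousContinuationStub….lean
  Summit.AnomalousDissipation.AnomalousDissipation.Theorems.stub_lapRecursionLipschitz

/-- **Stub (toy, S) — the doubling-map transfer operator halves Lipschitz constants** (card
lap-map-koopman-transfer, `DoublingTransferContracts`): merge-averaging `g ↦ (g(x/2) + g((x+1)/2))/2`
contracts fluctuations geometrically. [folklore] -/
theorem stub_doublingTransferContracts :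
    ∀ (g : ℝ → ℝ) (K : NNReal), LipschitzWith K g →
      LipschitzWith (K / 2) (fun x => (g (x / 2) + g ((x + 1) / 2)) / 2) :=
  -- LANDED p146557 (accepted 2026-08-17): Theorems/DyadicWallCascadeViscousContinuationStub….lean
  Summit.AnomalousDissipation.AnomalousDissipation.Theorems.stub_doublingTransferContracts

/-- **Stub (toy, S) — Saint-Venant dichotomy and its Liouville use-shape** (card
saint-venant-cap-impedance, `SaintVenantDichotomy` ∧ `SaintVenantLiouville`): (i) if `y ≤ c·y′` on
`(R₀, ∞)` with `c > 0` then `y R₀ · exp((R − R₀)/c) ≤ y R` (the function `y·e^{−(R−R₀)/c}` is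
non-decreasing); (ii) hence a non-negative such profile of sub-exponential growth vanishes identically.
[folklore] -/
theorem stub_saintVenant :
    (∀ (y : ℝ → ℝ) (R₀ c : ℝ), 0 < c → ContinuousOn y (Set.Ici R₀) → DifferentiableOn ℝ y (Set.Ioi R₀) →
      (∀ R, R₀ < R → y R ≤ c * deriv y R) → ∀ R, R₀ ≤ R → y R₀ * Real.exp ((R - R₀) / c) ≤ y R) ∧
    (∀ (y : ℝ → ℝ) (R₀ c : ℝ), 0 < c → ContinuousOn y (Set.Ici R₀) → DifferentiableOn ℝ y (Set.Ioi R₀) →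
      (∀ R, R₀ ≤ R → 0 ≤ y R) → (∀ R, R₀ < R → y R ≤ c * deriv y R) →
      (∀ ε, 0 < ε → ∃ R₁, ∀ R, R₁ ≤ R → y R ≤ ε * Real.exp ((R - R₀) / c)) →
      ∀ R, R₀ ≤ R → y R = 0) :=
  -- LANDED p148853 (accepted 2026-08-17): Theorems/DyadicWallCascadeViscousContinuationStub….lean
  Summit.AnomalousDissipation.AnomalousDissipation.Theorems.stub_saintVenant

/-! ## The chain -/

/-- **Stub (M, provable) — flux-sign normalisation of the seed.** Steady Euler is `V ↦ −V`
symmetric (`(−V·∇)(−V) = (V·∇)V`, same pressure), the mass flux stays `0` and the energy flux flips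
sign; so a half-space hierarchy may be taken with `F < 0` (inflow of energy from `z = +∞`, the sign the
viscous continuation forces: `F = J(+∞) = −∫⟨|∇W|²⟩ < 0`). [folklore] -/
theorem stub_fluxNeg :
    HalfSpaceHierarchy →
      ∃ (V : E³ → E³) (Q : E³ → ℝ) (C F : ℝ),
        ContDiffOn ℝ ((⊤ : ℕ∞) : WithTop ℕ∞) V {X : E³ | 0 < X 2} ∧
        ContDiffOn ℝ ((⊤ : ℕ∞) : WithTop ℕ∞) Q {X : E³ | 0 < X 2} ∧
        (∀ X : E³, 0 < X 2 → ‖V X‖ ≤ C ∧ |Q X| ≤ C) ∧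
        (∀ X : E³, 0 < X 2 → ∑ i : Fin 3, (fderiv ℝ V X (EuclideanSpace.single i (1 : ℝ))) i = 0) ∧
        (∀ X : E³, 0 < X 2 → (fderiv ℝ V X) (V X) + gradient Q X = 0) ∧
        (∀ X : E³, 0 < X 2 → V ((2 : ℝ) • X) = V X ∧ Q ((2 : ℝ) • X) = Q X) ∧
        (∀ X : E³, 1 ≤ X 2 → X 2 ≤ 2 →
          V (X + EuclideanSpace.single 0 (1 : ℝ)) = V X ∧ V (X + EuclideanSpace.single 1 (1 : ℝ)) = V X ∧
          Q (X + EuclideanSpace.single 0 (1 : ℝ)) = Q X ∧ Q (X + EuclideanSpace.single 1 (1 : ℝ)) = Q X) ∧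
        (∫ q in Set.Icc (0 : ℝ) 1 ×ˢ Set.Icc (0 : ℝ) 1, (V !₂[q.1, q.2, (1 : ℝ)]) 2 = 0) ∧
        F < 0 ∧
        (∫ q in Set.Icc (0 : ℝ) 1 ×ˢ Set.Icc (0 : ℝ) 1,
          (V !₂[q.1, q.2, (1 : ℝ)]) 2 * (‖V !₂[q.1, q.2, (1 : ℝ)]‖ ^ 2 / 2 + Q !₂[q.1, q.2, (1 : ℝ)]) = F) :=
  -- LANDED p148890 (accepted 2026-08-17): Theorems/DyadicWallCascadeViscousContinuationStub….lean
  Summit.AnomalousDissipation.AnomalousDissipation.Theorems.stub_fluxNeg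

/-- **Stub (XL, HARDEST, held by the lead) — the far-field wall profile (the line's transfer target
C⁺ in its weakest honest form).** From a half-space hierarchy with `F < 0` (the seed: its descending
tree and sheath skeleton), produce a bounded smooth mirror-symmetric divergence-free force-free steady
Navier–Stokes pair `(W, P)` on `ℝ³` at `ν = 1` with bounded pressure, converging UNIFORMLY AS `z → +∞`
to SOME half-space hierarchy `(V, Q)` (non-zero flux; the cards' cap-compatible `V̂`, an OUTPUT). The
cards' whole analytic programme — descending Koopman slaving (contraction ½), ascending
transfer-operator averaging, Saint-Venant layer solvability of the cap, interface equation
`𝒩_h = 𝒯_outer` with invertible linearisation — is what would prove this; none of its steps is a theorem in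
print or in the tree, and the statement defies the bounded steady Liouville conjecture (KNSS
arXiv:0709.3599, steady case). -/
theorem stub_farFieldWallProfile :
    (∃ (V : E³ → E³) (Q : E³ → ℝ) (C F : ℝ),
        ContDiffOn ℝ ((⊤ : ℕ∞) : WithTop ℕ∞) V {X : E³ | 0 < X 2} ∧
        ContDiffOn ℝ ((⊤ : ℕ∞) : WithTop ℕ∞) Q {X : E³ | 0 < X 2} ∧
        (∀ X : E³, 0 < X 2 → ‖V X‖ ≤ C ∧ |Q X| ≤ C) ∧
        (∀ X : E³, 0 < X 2 → ∑ i : Fin 3, (fderiv ℝ V X (EuclideanSpace.single i (1 : ℝ))) i = 0) ∧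
        (∀ X : E³, 0 < X 2 → (fderiv ℝ V X) (V X) + gradient Q X = 0) ∧
        (∀ X : E³, 0 < X 2 → V ((2 : ℝ) • X) = V X ∧ Q ((2 : ℝ) • X) = Q X) ∧
        (∀ X : E³, 1 ≤ X 2 → X 2 ≤ 2 →
          V (X + EuclideanSpace.single 0 (1 : ℝ)) = V X ∧ V (X + EuclideanSpace.single 1 (1 : ℝ)) = V X ∧
          Q (X + EuclideanSpace.single 0 (1 : ℝ)) = Q X ∧ Q (X + EuclideanSpace.single 1 (1 : ℝ)) = Q X) ∧
        (∫ q in Set.Icc (0 : ℝ) 1 ×ˢ Set.Icc (0 : ℝ) 1, (V !₂[q.1, q.2, (1 : ℝ)]) 2 = 0) ∧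
        F < 0 ∧
        (∫ q in Set.Icc (0 : ℝ) 1 ×ˢ Set.Icc (0 : ℝ) 1,
          (V !₂[q.1, q.2, (1 : ℝ)]) 2 * (‖V !₂[q.1, q.2, (1 : ℝ)]‖ ^ 2 / 2 + Q !₂[q.1, q.2, (1 : ℝ)]) = F)) →
    ∃ (W : E³ → E³) (P : E³ → ℝ) (V : E³ → E³) (Q : E³ → ℝ) (C F C' : ℝ),
      (ContDiffOn ℝ ((⊤ : ℕ∞) : WithTop ℕ∞) V {X : E³ | 0 < X 2} ∧
        ContDiffOn ℝ ((⊤ : ℕ∞) : WithTop ℕ∞) Q {X : E³ | 0 < X 2} ∧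
        (∀ X : E³, 0 < X 2 → ‖V X‖ ≤ C ∧ |Q X| ≤ C) ∧
        (∀ X : E³, 0 < X 2 → ∑ i : Fin 3, (fderiv ℝ V X (EuclideanSpace.single i (1 : ℝ))) i = 0) ∧
        (∀ X : E³, 0 < X 2 → (fderiv ℝ V X) (V X) + gradient Q X = 0) ∧
        (∀ X : E³, 0 < X 2 → V ((2 : ℝ) • X) = V X ∧ Q ((2 : ℝ) • X) = Q X) ∧
        (∀ X : E³, 1 ≤ X 2 → X 2 ≤ 2 →
          V (X + EuclideanSpace.single 0 (1 : ℝ)) = V X ∧ V (X + EuclideanSpace.single 1 (1 : ℝ)) = V X ∧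
          Q (X + EuclideanSpace.single 0 (1 : ℝ)) = Q X ∧ Q (X + EuclideanSpace.single 1 (1 : ℝ)) = Q X) ∧
        (∫ q in Set.Icc (0 : ℝ) 1 ×ˢ Set.Icc (0 : ℝ) 1, (V !₂[q.1, q.2, (1 : ℝ)]) 2 = 0) ∧
        F ≠ 0 ∧
        (∫ q in Set.Icc (0 : ℝ) 1 ×ˢ Set.Icc (0 : ℝ) 1,
          (V !₂[q.1, q.2, (1 : ℝ)]) 2 * (‖V !₂[q.1, q.2, (1 : ℝ)]‖ ^ 2 / 2 + Q !₂[q.1, q.2, (1 : ℝ)]) = F)) ∧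
      ContDiff ℝ ((⊤ : ℕ∞) : WithTop ℕ∞) W ∧ ContDiff ℝ ((⊤ : ℕ∞) : WithTop ℕ∞) P ∧
      (∀ X, ‖W X‖ ≤ C' ∧ |P X| ≤ C') ∧
      (∀ X : E³, W (X - (2 * X 2) • EuclideanSpace.single 2 (1 : ℝ)) =
          W X - (2 * W X 2) • EuclideanSpace.single 2 (1 : ℝ) ∧
        P (X - (2 * X 2) • EuclideanSpace.single 2 (1 : ℝ)) = P X) ∧
      (∀ X : E³, ∑ i : Fin 3, (fderiv ℝ W X (EuclideanSpace.single i (1 : ℝ))) i = 0) ∧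
      (∀ X : E³, (fderiv ℝ W X) (W X) + gradient P X =
        ∑ i : Fin 3, fderiv ℝ (fun Y => fderiv ℝ W Y (EuclideanSpace.single i (1 : ℝ))) X
          (EuclideanSpace.single i (1 : ℝ))) ∧
      (∀ ε : ℝ, 0 < ε → ∃ Z : ℝ, ∀ X : E³, Z ≤ X 2 → ‖W X - V X‖ ≤ ε ∧ |P X - Q X| ≤ ε) := by
  sorry

/-- **Stub (S, provable) — far-field uniform convergence + dilation invariance ⇒ dyadic band
blow-down.** If `(V, Q)` is invariant under `X ↦ 2X` on the upper half-space and `(W, P) − (V, Q) → 0`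
uniformly as `z → +∞`, then `(W, P)(2^m X) → (V, Q)(X)` uniformly on the band `1 ≤ z ≤ 2`
(`V (2^m X) = V X` there and `(2^m X)₃ ≥ 2^m`). [folklore] -/
theorem stub_blowDownOfFarField :
    ∀ (W V : E³ → E³) (P Q : E³ → ℝ),
      (∀ X : E³, 0 < X 2 → V ((2 : ℝ) • X) = V X ∧ Q ((2 : ℝ) • X) = Q X) →
      (∀ ε : ℝ, 0 < ε → ∃ Z : ℝ, ∀ X : E³, Z ≤ X 2 → ‖W X - V X‖ ≤ ε ∧ |P X - Q X| ≤ ε) →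
      ∀ ε : ℝ, 0 < ε → ∃ M : ℕ, ∀ m : ℕ, M ≤ m → ∀ X : E³, 1 ≤ X 2 → X 2 ≤ 2 →
        ‖W ((2 : ℝ) ^ m • X) - V X‖ ≤ ε ∧ |P ((2 : ℝ) ^ m • X) - Q X| ≤ ε :=
  -- LANDED p146560 (accepted 2026-08-17): Theorems/DyadicWallCascadeViscousContinuationStub….lean
  Summit.AnomalousDissipation.AnomalousDissipation.Theorems.stub_blowDownOfFarField

/-! ## The crux from the line -/

/-- **The crux from the line** — the ONLY theorem of this file concluding
`Summit.AnomalousDissipation.AnomalousDissipation.Theses.DyadicWallCascade.ViscousContinuation`, BY NAME,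
with no hypotheses. Chain: hierarchy ⟹ (stub_fluxNeg) hierarchy with `F < 0` ⟹
(stub_farFieldWallProfile) far-field wall profile ⟹ (stub_blowDownOfFarField) the band blow-down
clause, the other clauses carried verbatim. -/
theorem ViscousContinuation_of :
    Summit.AnomalousDissipation.AnomalousDissipation.Theses.DyadicWallCascade.ViscousContinuation := by
  intro h
  obtain ⟨W, P, V, Q, C, F, C', hcore⟩ := stub_farFieldWallProfile (stub_fluxNeg h)
  obtain ⟨hhier, hWs, hPs, hbdd, hmir, hdiv, hns, hfar⟩ := hcore
  refine ⟨W, P, V, Q, C, F, C', hhier, hWs, hPs, hbdd, hmir, hdiv, hns, ?_⟩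
  have hdil : ∀ X : E³, 0 < X 2 → V ((2 : ℝ) • X) = V X ∧ Q ((2 : ℝ) • X) = Q X :=
    fun X hX => hhier.2.2.2.2.2.1 X hX
  exact stub_blowDownOfFarField W V P Q hdil hfar

/-! ## Costume certificate (lead, cycle 1): the only open stub is the crux re-dressed -/

/-- **Stub (S, provable) — the flux-normalised seed IS the hierarchy.** `F < 0 ⇒ F ≠ 0` and the
inlined clause block is the route decl's `let`-block by `rfl`; the converse is `stub_fluxNeg`
(`V ↦ −V`). Registered so that the certificate below is kernel-checked modulo named stubs. [folklore] -/
theorem stub_seedIffHierarchy :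
    (∃ (V : E³ → E³) (Q : E³ → ℝ) (C F : ℝ),
        ContDiffOn ℝ ((⊤ : ℕ∞) : WithTop ℕ∞) V {X : E³ | 0 < X 2} ∧
        ContDiffOn ℝ ((⊤ : ℕ∞) : WithTop ℕ∞) Q {X : E³ | 0 < X 2} ∧
        (∀ X : E³, 0 < X 2 → ‖V X‖ ≤ C ∧ |Q X| ≤ C) ∧
        (∀ X : E³, 0 < X 2 → ∑ i : Fin 3, (fderiv ℝ V X (EuclideanSpace.single i (1 : ℝ))) i = 0) ∧
        (∀ X : E³, 0 < X 2 → (fderiv ℝ V X) (V X) + gradient Q X = 0) ∧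
        (∀ X : E³, 0 < X 2 → V ((2 : ℝ) • X) = V X ∧ Q ((2 : ℝ) • X) = Q X) ∧
        (∀ X : E³, 1 ≤ X 2 → X 2 ≤ 2 →
          V (X + EuclideanSpace.single 0 (1 : ℝ)) = V X ∧ V (X + EuclideanSpace.single 1 (1 : ℝ)) = V X ∧
          Q (X + EuclideanSpace.single 0 (1 : ℝ)) = Q X ∧ Q (X + EuclideanSpace.single 1 (1 : ℝ)) = Q X) ∧
        (∫ q in Set.Icc (0 : ℝ) 1 ×ˢ Set.Icc (0 : ℝ) 1, (V !₂[q.1, q.2, (1 : ℝ)]) 2 = 0) ∧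
        F < 0 ∧
        (∫ q in Set.Icc (0 : ℝ) 1 ×ˢ Set.Icc (0 : ℝ) 1,
          (V !₂[q.1, q.2, (1 : ℝ)]) 2 * (‖V !₂[q.1, q.2, (1 : ℝ)]‖ ^ 2 / 2 + Q !₂[q.1, q.2, (1 : ℝ)]) = F)) ↔ HalfSpaceHierarchy :=
  -- LANDED p150090 (accepted 2026-08-17): Theorems/DyadicWallCascadeViscousContinuationStub….lean
  Summit.AnomalousDissipation.AnomalousDissipation.Theorems.stub_seedIffHierarchy

/-- **Stub (M, provable) — the far-field wall profile IS the viscous wall profile** (item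
stmt-AnomalousDissipation-17919, decl `ViscousWallProfile`). `→`: `stub_blowDownOfFarField` (landed
p146560). `←`: for `X` with `X 2 ≥ 2^M` pick `m ≥ M` with `2^m ≤ X 2 < 2^(m+1)` (`exists_nat_pow_near`),
put `Y := (2^m)⁻¹ • X` (so `1 ≤ Y 2 < 2`, `X = 2^m • Y`, `V X = V Y`, `Q X = Q Y` by iterated dilation
invariance) and apply the band blow-down clause at `(m, Y)`. [folklore] -/
theorem stub_farFieldIffViscousWallProfile :
    (∃ (W : E³ → E³) (P : E³ → ℝ) (V : E³ → E³) (Q : E³ → ℝ) (C F C' : ℝ),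
      (ContDiffOn ℝ ((⊤ : ℕ∞) : WithTop ℕ∞) V {X : E³ | 0 < X 2} ∧
        ContDiffOn ℝ ((⊤ : ℕ∞) : WithTop ℕ∞) Q {X : E³ | 0 < X 2} ∧
        (∀ X : E³, 0 < X 2 → ‖V X‖ ≤ C ∧ |Q X| ≤ C) ∧
        (∀ X : E³, 0 < X 2 → ∑ i : Fin 3, (fderiv ℝ V X (EuclideanSpace.single i (1 : ℝ))) i = 0) ∧
        (∀ X : E³, 0 < X 2 → (fderiv ℝ V X) (V X) + gradient Q X = 0) ∧
        (∀ X : E³, 0 < X 2 → V ((2 : ℝ) • X) = V X ∧ Q ((2 : ℝ) • X) = Q X) ∧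
        (∀ X : E³, 1 ≤ X 2 → X 2 ≤ 2 →
          V (X + EuclideanSpace.single 0 (1 : ℝ)) = V X ∧ V (X + EuclideanSpace.single 1 (1 : ℝ)) = V X ∧
          Q (X + EuclideanSpace.single 0 (1 : ℝ)) = Q X ∧ Q (X + EuclideanSpace.single 1 (1 : ℝ)) = Q X) ∧
        (∫ q in Set.Icc (0 : ℝ) 1 ×ˢ Set.Icc (0 : ℝ) 1, (V !₂[q.1, q.2, (1 : ℝ)]) 2 = 0) ∧
        F ≠ 0 ∧
        (∫ q in Set.Icc (0 : ℝ) 1 ×ˢ Set.Icc (0 : ℝ) 1,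
          (V !₂[q.1, q.2, (1 : ℝ)]) 2 * (‖V !₂[q.1, q.2, (1 : ℝ)]‖ ^ 2 / 2 + Q !₂[q.1, q.2, (1 : ℝ)]) = F)) ∧
      ContDiff ℝ ((⊤ : ℕ∞) : WithTop ℕ∞) W ∧ ContDiff ℝ ((⊤ : ℕ∞) : WithTop ℕ∞) P ∧
      (∀ X, ‖W X‖ ≤ C' ∧ |P X| ≤ C') ∧
      (∀ X : E³, W (X - (2 * X 2) • EuclideanSpace.single 2 (1 : ℝ)) =
          W X - (2 * W X 2) • EuclideanSpace.single 2 (1 : ℝ) ∧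
        P (X - (2 * X 2) • EuclideanSpace.single 2 (1 : ℝ)) = P X) ∧
      (∀ X : E³, ∑ i : Fin 3, (fderiv ℝ W X (EuclideanSpace.single i (1 : ℝ))) i = 0) ∧
      (∀ X : E³, (fderiv ℝ W X) (W X) + gradient P X =
        ∑ i : Fin 3, fderiv ℝ (fun Y => fderiv ℝ W Y (EuclideanSpace.single i (1 : ℝ))) X
          (EuclideanSpace.single i (1 : ℝ))) ∧
      (∀ ε : ℝ, 0 < ε → ∃ Z : ℝ, ∀ X : E³, Z ≤ X 2 → ‖W X - V X‖ ≤ ε ∧ |P X - Q X| ≤ ε)) ↔ ViscousWallProfile :=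
  -- LANDED p149958 (accepted 2026-08-17): Theorems/DyadicWallCascadeViscousContinuationStub….lean
  Summit.AnomalousDissipation.AnomalousDissipation.Theorems.stub_farFieldIffViscousWallProfile

/-- **COSTUME CERTIFICATE (lead, cycle 1).** The signature of the line's one open stub
`stub_farFieldWallProfile` is EQUIVALENT to the crux `ViscousContinuation` (kernel-checked modulo the
two provable transfer stubs above): the line `Sketch` has no content left between its open stub and
the crux — by the planners' rule (CRUX-PLAN "COSTUME: a stub restating the crux") it is not a
decomposition. -/
theorem farFieldWallProfile_iff_viscousContinuation :
    ((∃ (V : E³ → E³) (Q : E³ → ℝ) (C F : ℝ),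
        ContDiffOn ℝ ((⊤ : ℕ∞) : WithTop ℕ∞) V {X : E³ | 0 < X 2} ∧
        ContDiffOn ℝ ((⊤ : ℕ∞) : WithTop ℕ∞) Q {X : E³ | 0 < X 2} ∧
        (∀ X : E³, 0 < X 2 → ‖V X‖ ≤ C ∧ |Q X| ≤ C) ∧
        (∀ X : E³, 0 < X 2 → ∑ i : Fin 3, (fderiv ℝ V X (EuclideanSpace.single i (1 : ℝ))) i = 0) ∧
        (∀ X : E³, 0 < X 2 → (fderiv ℝ V X) (V X) + gradient Q X = 0) ∧
        (∀ X : E³, 0 < X 2 → V ((2 : ℝ) • X) = V X ∧ Q ((2 : ℝ) • X) = Q X) ∧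
        (∀ X : E³, 1 ≤ X 2 → X 2 ≤ 2 →
          V (X + EuclideanSpace.single 0 (1 : ℝ)) = V X ∧ V (X + EuclideanSpace.single 1 (1 : ℝ)) = V X ∧
          Q (X + EuclideanSpace.single 0 (1 : ℝ)) = Q X ∧ Q (X + EuclideanSpace.single 1 (1 : ℝ)) = Q X) ∧
        (∫ q in Set.Icc (0 : ℝ) 1 ×ˢ Set.Icc (0 : ℝ) 1, (V !₂[q.1, q.2, (1 : ℝ)]) 2 = 0) ∧
        F < 0 ∧
        (∫ q in Set.Icc (0 : ℝ) 1 ×ˢ Set.Icc (0 : ℝ) 1,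
          (V !₂[q.1, q.2, (1 : ℝ)]) 2 * (‖V !₂[q.1, q.2, (1 : ℝ)]‖ ^ 2 / 2 + Q !₂[q.1, q.2, (1 : ℝ)]) = F)) →
    ∃ (W : E³ → E³) (P : E³ → ℝ) (V : E³ → E³) (Q : E³ → ℝ) (C F C' : ℝ),
      (ContDiffOn ℝ ((⊤ : ℕ∞) : WithTop ℕ∞) V {X : E³ | 0 < X 2} ∧
        ContDiffOn ℝ ((⊤ : ℕ∞) : WithTop ℕ∞) Q {X : E³ | 0 < X 2} ∧
        (∀ X : E³, 0 < X 2 → ‖V X‖ ≤ C ∧ |Q X| ≤ C) ∧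
        (∀ X : E³, 0 < X 2 → ∑ i : Fin 3, (fderiv ℝ V X (EuclideanSpace.single i (1 : ℝ))) i = 0) ∧
        (∀ X : E³, 0 < X 2 → (fderiv ℝ V X) (V X) + gradient Q X = 0) ∧
        (∀ X : E³, 0 < X 2 → V ((2 : ℝ) • X) = V X ∧ Q ((2 : ℝ) • X) = Q X) ∧
        (∀ X : E³, 1 ≤ X 2 → X 2 ≤ 2 →
          V (X + EuclideanSpace.single 0 (1 : ℝ)) = V X ∧ V (X + EuclideanSpace.single 1 (1 : ℝ)) = V X ∧
          Q (X + EuclideanSpace.single 0 (1 : ℝ)) = Q X ∧ Q (X + EuclideanSpace.single 1 (1 : ℝ)) = Q X) ∧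
        (∫ q in Set.Icc (0 : ℝ) 1 ×ˢ Set.Icc (0 : ℝ) 1, (V !₂[q.1, q.2, (1 : ℝ)]) 2 = 0) ∧
        F ≠ 0 ∧
        (∫ q in Set.Icc (0 : ℝ) 1 ×ˢ Set.Icc (0 : ℝ) 1,
          (V !₂[q.1, q.2, (1 : ℝ)]) 2 * (‖V !₂[q.1, q.2, (1 : ℝ)]‖ ^ 2 / 2 + Q !₂[q.1, q.2, (1 : ℝ)]) = F)) ∧
      ContDiff ℝ ((⊤ : ℕ∞) : WithTop ℕ∞) W ∧ ContDiff ℝ ((⊤ : ℕ∞) : WithTop ℕ∞) P ∧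
      (∀ X, ‖W X‖ ≤ C' ∧ |P X| ≤ C') ∧
      (∀ X : E³, W (X - (2 * X 2) • EuclideanSpace.single 2 (1 : ℝ)) =
          W X - (2 * W X 2) • EuclideanSpace.single 2 (1 : ℝ) ∧
        P (X - (2 * X 2) • EuclideanSpace.single 2 (1 : ℝ)) = P X) ∧
      (∀ X : E³, ∑ i : Fin 3, (fderiv ℝ W X (EuclideanSpace.single i (1 : ℝ))) i = 0) ∧
      (∀ X : E³, (fderiv ℝ W X) (W X) + gradient P X =
        ∑ i : Fin 3, fderiv ℝ (fun Y => fderiv ℝ W Y (EuclideanSpace.single i (1 : ℝ))) X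
          (EuclideanSpace.single i (1 : ℝ))) ∧
      (∀ ε : ℝ, 0 < ε → ∃ Z : ℝ, ∀ X : E³, Z ≤ X 2 → ‖W X - V X‖ ≤ ε ∧ |P X - Q X| ≤ ε)) ↔
    Summit.AnomalousDissipation.AnomalousDissipation.Theses.DyadicWallCascade.ViscousContinuation := by
  constructor
  · intro hcore h
    exact stub_farFieldIffViscousWallProfile.1 (hcore (stub_seedIffHierarchy.2 h))
  · intro hvc hseed
    exact stub_farFieldIffViscousWallProfile.2 (hvc (stub_seedIffHierarchy.1 hseed))

end Summit.AnomalousDissipation.AnomalousDissipation.Cruxes.ViscousContinuation.Sketch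

end
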